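import Summits.CriticalPhenomena.Ising3DConformalLimit.Theses.VolterraWard

/-!
# Birth skeleton for crux `WallCrossingContinuity` (stmt-CriticalPhenomena-11224)

Route `VolterraWard` (sub-problem `Ising3DConformalLimit`), crux rank 4, decl
`Summit.CriticalPhenomena.Ising3DConformalLimit.Theses.VolterraWard.WallCrossingContinuity` (KIN):
for every `n`, compact `K ⊆ NonCoincident 3 n`, height `t` and `η > 0` there is `h₀` such that for
`h < h₀`, then `w`, then `ε`, then `δ` small, then `N` large, uniformly in `x ∈ K`, the `ε`-odd twisted
free-box responses `D` with the twist wall at `⌊(t+h)/δ⌋` and at `⌊(t−h)/δ⌋` differ by at most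
`η·ε·⟨∏σ⟩⁺_{β_c}` — crossing the height `t` with the wall produces no `O(ε)` jump.

## The line: REGIME SPLIT by the position of the insertion heights of `x` relative to `t`

Fix a separation scale `κ > 0`. For a configuration `x : Fin n → ℝ³` exactly one of the following holds
(pure logic, per configuration):

* FAR      `∀ i, κ ≤ |x i 2 − t|`                                   — no insertion within `κ` of the height `t`;
* PINNED   `(∃ i, x i 2 = t) ∧ ∀ i, x i 2 = t ∨ κ ≤ |x i 2 − t|`      — some insertions exactly AT height `t`,
                                                                        every other one `κ`-far;
* NEAR     `∃ i, 0 < |x i 2 − t| < κ`                                — an insertion at a small NONZERO offset.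

The three registered stubs are the crux restricted (by a guard on the innermost `∀ x ∈ K`) to each regime,
and they isolate three mathematically different mechanisms:

* `stub_farHeights` (∀ κ) — THIN-SLAB FLUX CONSERVATION. For `h < κ` the closed slab `[t−h, t+h]` is
  insertion-free for the guarded configurations, so this is the symmetric thin-slab case of the route's
  rank-2 crux `TwistFluxConservation` (INV, stmt-CriticalPhenomena-11222) on the compact
  `K_far = {x ∈ K | ∀ i, κ ≤ |x i 2 − t|}`: moving the wall inside an insertion-free slab is invisible at
  `O(ε)` (conservation of the angular-momentum flux). Open (it is emergent isotropy in thin-slab form);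
  implied by INV by restriction of `K` (a prover who lands INV closes this stub with an `IsCompact`/`⊆`
  bookkeeping lemma). Size: open-problem (≈ INV).
* `stub_pinnedCrossing` (∀ κ) — THE SYMMETRIC CROSSING, the designed content of KIN (card V4): insertions
  sitting exactly at height `t` are crossed symmetrically by the pair of walls `t ± h`, `h → 0` BEFORE
  `w → 0`, so the pinned insertion is `h/δ → ∞` layers away from both walls and never inside a wall layer;
  the claim is that the wall's contact term at an insertion vanishes (the plane integral of `T_[xy]·σ` is odd
  under both in-plane mirrors; on the lattice: the side-exchange automorphism `Θ_A` and `μ × id :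
  G_A^{−M} ≅ G_A^{M}` recorded by the refuters, EVIDENCE.md on the item). Size XL.
* `stub_nearHeights` (∃ κ) — UNIFORM NEAR-CROSSING: control, uniform on `K`, of configurations with an
  insertion at a small nonzero offset `s` from `t`, `0 < |s| < κ`, where for `h = |s|` the insertion lands in
  (or next to) the wall layer `⌊(t ± h)/δ⌋` beside screw cores of Burgers length `M = ⌊ε⌊w/δ⌋⌋ → ∞`.
  This is EXACTLY the disputed part of the crux as typed (refuter dissent rattack-11120-0,
  ATTACK-11224-dissent.md / W.lean / R.lean on the item: "∀K over-reach", witness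
  `K = {((u,0,s),(5,5,s+10))}`, `s = h`); two concurring attacks (rattack-10967-0, rattack-11224-0) grade the
  crux SURVIVES. `κ` is existential (chosen after `K, t, η`), so for every `K` whose insertion heights do not
  accumulate at `t` from outside the stub is vacuous; it carries content only on the dissent's configurations.
  If this stub is refuted (`stub-false`), the crux as typed is refuted-MISSTATED and its repair is the
  refuter's `C′` (side condition `∃ κ > 0, ∀ x ∈ K, ∀ i, x i 2 = t ∨ κ ≤ |x i 2 − t|`, R.lean
  `Refuter.VolterraWard.WallCrossingContinuityRepaired`), which is precisely
  `stub_farHeights ∧ stub_pinnedCrossing` (same composition as below, minus the NEAR case). Size XL / decides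
  the typing of the crux.

`WallCrossingContinuity_of` — the crux BY NAME from the three stub statements, sorry-free: `delta` + `intro`
of the crux's three `let`s, instantiate each stub at them with `rfl`, obtain `κ` from NEAR, take `min` of the
three thresholds at each of the four real levels and `max` at the `N` level, and split on the trichotomy.

Spelling. The stubs are stated over existing `Literature.Probability.LatticeModels` declarations only
(`Site`, `box`, `isingExpect`, `BoundaryCondition.free`, `spinAt`, `criticalBeta`, `criticalCorr`,
`latticeApprox`, `NonCoincident`), with the crux's three `let`s (`F` = brickwork map, `C` = twisted free-box
critical correlator, `D` = `ε`-odd response) turned into universally quantified functions pinned by their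
defining equations `F = …`, `C = …`, `D = …` (verbatim right-hand sides of the crux; a prover `subst`s them;
cf. the named in-tree objects `brickworkMap`, `twistCorr`, `twistOddResponse` of
`Literature/Probability/LatticeModels/{BrickworkMap,TwistCorr}.lean`, equal to these up to the in-tree bridge
lemmas, deliberately NOT used here so that the stubs are definitionally the crux's own terms).

Honest difficulty: all three stubs are open; none is the crux or the summit in disguise (each is a strict
guard-restriction of the crux; BC3 probes `stub → WallCrossingContinuity` and `stub → Ising3DConformalLimit`
by `first | exact? | simpa [stub] | (unfold stub; simpa) | aesop` all FAIL — registrar's NOTES.md / Lines/birth.md).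
Disproof.lean: none exists for this crux (no `_false_without_` obligations; `ledger crux ls` empty at registration).
-/

namespace Summit.CriticalPhenomena.Ising3DConformalLimit.Cruxes.WallCrossingContinuity.Birth

/-! ## The stubs (the only `sorry`s of this file; each statement spelled out, `:=`-free) -/

/-- **FAR — thin-slab flux conservation.** The crux restricted to configurations all of whose insertion
heights are `κ`-far from `t` (every `κ > 0`). The symmetric thin-slab case of `TwistFluxConservation`
(INV) on `K_far`; open (≈ INV); implied by INV by restricting `K`. -/
theorem stub_farHeights :
  open Literature.Probability.LatticeModels in
  (∀ (F : ℕ → ℤ → Site 3 → Site 3) (C D : (N W : ℕ) → (M A : ℤ) → (n : ℕ) → (Fin n → Site 3) → ℝ),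
    F = ((fun W M p i => if i = 0 then p 0 - M * (p 1 / (W : ℤ)) else if i = 1 then p 1 + M * ((p 0 - M * (p 1 / (W : ℤ))) / (W : ℤ)) else p 2) : ℕ → ℤ → Site 3 → Site 3) →
    C = ((fun N W M A _n y => isingExpect (SimpleGraph.fromRel fun a b : ↥(box 3 N) => (a.1 2 = b.1 2 ∧ a.1 2 ≤ A ∧ |a.1 0 - b.1 0| + |a.1 1 - b.1 1| = 1) ∨ (a.1 2 = b.1 2 ∧ A < a.1 2 ∧ |F W M a.1 0 - F W M b.1 0| + |F W M a.1 1 - F W M b.1 1| = 1) ∨ (a.1 0 = b.1 0 ∧ a.1 1 = b.1 1 ∧ |a.1 2 - b.1 2| = 1)) Finset.univ (criticalBeta 3) 0 BoundaryCondition.free (fun s => ∏ i, if h : y i ∈ box 3 N then spinAt (⟨y i, h⟩ : ↥(box 3 N)) s else 0)) : (N W : ℕ) → (M A : ℤ) → (n : ℕ) → (Fin n → Site 3) → ℝ) →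
    D = ((fun N W M A n y => C N W M A n y - C N W (-M) A n y) : (N W : ℕ) → (M A : ℤ) → (n : ℕ) → (Fin n → Site 3) → ℝ) →
    ∀ (κ : ℝ), 0 < κ →
    ∀ (n : ℕ) (K : Set (Fin n → EuclideanSpace ℝ (Fin 3))), K ⊆ NonCoincident 3 n → IsCompact K →
    ∀ (t η : ℝ), 0 < η → ∃ h₀ > (0 : ℝ), ∀ h ∈ Set.Ioo 0 h₀, ∃ w₀ > (0 : ℝ), ∀ w ∈ Set.Ioo 0 w₀,
    ∃ ε₀ > (0 : ℝ), ∀ ε ∈ Set.Ioo 0 ε₀, ∃ δ₀ > (0 : ℝ), ∀ δ ∈ Set.Ioo 0 δ₀, ∃ N₀ : ℕ, ∀ N ≥ N₀, ∀ x ∈ K,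
      (∀ i, κ ≤ |x i 2 - t|) →
      |D N ⌊w / δ⌋₊ ⌊ε * ⌊w / δ⌋₊⌋ ⌊(t + h) / δ⌋ n (fun i => latticeApprox δ (x i)) -
        D N ⌊w / δ⌋₊ ⌊ε * ⌊w / δ⌋₊⌋ ⌊(t - h) / δ⌋ n (fun i => latticeApprox δ (x i))| ≤
      η * ε * criticalCorr 3 n (fun i => latticeApprox δ (x i))) := by
  sorry

/-- **PINNED — the symmetric crossing (KIN proper).** The crux restricted to configurations with some
insertion exactly at height `t` and every other insertion at `t` or `κ`-far (every `κ > 0`): no `O(ε)`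
contact term when the pair of walls `t ± h` closes symmetrically on a pinned insertion. Open, XL. -/
theorem stub_pinnedCrossing :
  open Literature.Probability.LatticeModels in
  (∀ (F : ℕ → ℤ → Site 3 → Site 3) (C D : (N W : ℕ) → (M A : ℤ) → (n : ℕ) → (Fin n → Site 3) → ℝ),
    F = ((fun W M p i => if i = 0 then p 0 - M * (p 1 / (W : ℤ)) else if i = 1 then p 1 + M * ((p 0 - M * (p 1 / (W : ℤ))) / (W : ℤ)) else p 2) : ℕ → ℤ → Site 3 → Site 3) →
    C = ((fun N W M A _n y => isingExpect (SimpleGraph.fromRel fun a b : ↥(box 3 N) => (a.1 2 = b.1 2 ∧ a.1 2 ≤ A ∧ |a.1 0 - b.1 0| + |a.1 1 - b.1 1| = 1) ∨ (a.1 2 = b.1 2 ∧ A < a.1 2 ∧ |F W M a.1 0 - F W M b.1 0| + |F W M a.1 1 - F W M b.1 1| = 1) ∨ (a.1 0 = b.1 0 ∧ a.1 1 = b.1 1 ∧ |a.1 2 - b.1 2| = 1)) Finset.univ (criticalBeta 3) 0 BoundaryCondition.free (fun s => ∏ i, if h : y i ∈ box 3 N then spinAt (⟨y i, h⟩ : ↥(box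 3 N)) s else 0)) : (N W : ℕ) → (M A : ℤ) → (n : ℕ) → (Fin n → Site 3) → ℝ) →
    D = ((fun N W M A n y => C N W M A n y - C N W (-M) A n y) : (N W : ℕ) → (M A : ℤ) → (n : ℕ) → (Fin n → Site 3) → ℝ) →
    ∀ (κ : ℝ), 0 < κ →
    ∀ (n : ℕ) (K : Set (Fin n → EuclideanSpace ℝ (Fin 3))), K ⊆ NonCoincident 3 n → IsCompact K →
    ∀ (t η : ℝ), 0 < η → ∃ h₀ > (0 : ℝ), ∀ h ∈ Set.Ioo 0 h₀, ∃ w₀ > (0 : ℝ), ∀ w ∈ Set.Ioo 0 w₀,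
    ∃ ε₀ > (0 : ℝ), ∀ ε ∈ Set.Ioo 0 ε₀, ∃ δ₀ > (0 : ℝ), ∀ δ ∈ Set.Ioo 0 δ₀, ∃ N₀ : ℕ, ∀ N ≥ N₀, ∀ x ∈ K,
      ((∃ i, x i 2 = t) ∧ ∀ i, x i 2 = t ∨ κ ≤ |x i 2 - t|) →
      |D N ⌊w / δ⌋₊ ⌊ε * ⌊w / δ⌋₊⌋ ⌊(t + h) / δ⌋ n (fun i => latticeApprox δ (x i)) -
        D N ⌊w / δ⌋₊ ⌊ε * ⌊w / δ⌋₊⌋ ⌊(t - h) / δ⌋ n (fun i => latticeApprox δ (x i))| ≤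
      η * ε * criticalCorr 3 n (fun i => latticeApprox δ (x i))) := by
  sorry

/-- **NEAR — uniform near-crossing (the disputed over-reach).** For some `κ > 0` (after `K, t, η`): the crux
restricted to configurations with an insertion at a nonzero offset `< κ` from `t`, uniformly on `K`.
Exactly the part of the crux contested by the refuter dissent (insertion in the wall layer next to a
screw core); its refutation would make the crux refuted-misstated with repair `C′ = FAR ∧ PINNED`. XL. -/
theorem stub_nearHeights :
  open Literature.Probability.LatticeModels in
  (∀ (F : ℕ → ℤ → Site 3 → Site 3) (C D : (N W : ℕ) → (M A : ℤ) → (n : ℕ) → (Fin n → Site 3) → ℝ),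
    F = ((fun W M p i => if i = 0 then p 0 - M * (p 1 / (W : ℤ)) else if i = 1 then p 1 + M * ((p 0 - M * (p 1 / (W : ℤ))) / (W : ℤ)) else p 2) : ℕ → ℤ → Site 3 → Site 3) →
    C = ((fun N W M A _n y => isingExpect (SimpleGraph.fromRel fun a b : ↥(box 3 N) => (a.1 2 = b.1 2 ∧ a.1 2 ≤ A ∧ |a.1 0 - b.1 0| + |a.1 1 - b.1 1| = 1) ∨ (a.1 2 = b.1 2 ∧ A < a.1 2 ∧ |F W M a.1 0 - F W M b.1 0| + |F W M a.1 1 - F W M b.1 1| = 1) ∨ (a.1 0 = b.1 0 ∧ a.1 1 = b.1 1 ∧ |a.1 2 - b.1 2| = 1)) Finset.univ (criticalBeta 3) 0 BoundaryCondition.free (fun s => ∏ i, if h : y i ∈ box 3 N then spinAt (⟨y i, h⟩ : ↥(box 3 N)) s else 0)) : (N W : ℕ) → (M A : ℤ) → (n : ℕ) → (Fin n → Site 3) → ℝ) →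
    D = ((fun N W M A n y => C N W M A n y - C N W (-M) A n y) : (N W : ℕ) → (M A : ℤ) → (n : ℕ) → (Fin n → Site 3) → ℝ) →
    ∀ (n : ℕ) (K : Set (Fin n → EuclideanSpace ℝ (Fin 3))), K ⊆ NonCoincident 3 n → IsCompact K →
    ∀ (t η : ℝ), 0 < η → ∃ κ > (0 : ℝ), ∃ h₀ > (0 : ℝ), ∀ h ∈ Set.Ioo 0 h₀, ∃ w₀ > (0 : ℝ), ∀ w ∈ Set.Ioo 0 w₀,
    ∃ ε₀ > (0 : ℝ), ∀ ε ∈ Set.Ioo 0 ε₀, ∃ δ₀ > (0 : ℝ), ∀ δ ∈ Set.Ioo 0 δ₀, ∃ N₀ : ℕ, ∀ N ≥ N₀, ∀ x ∈ K,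
      (∃ i, 0 < |x i 2 - t| ∧ |x i 2 - t| < κ) →
      |D N ⌊w / δ⌋₊ ⌊ε * ⌊w / δ⌋₊⌋ ⌊(t + h) / δ⌋ n (fun i => latticeApprox δ (x i)) -
        D N ⌊w / δ⌋₊ ⌊ε * ⌊w / δ⌋₊⌋ ⌊(t - h) / δ⌋ n (fun i => latticeApprox δ (x i))| ≤
      η * ε * criticalCorr 3 n (fun i => latticeApprox δ (x i))) := by
  sorry


/-! ## Name-keyed aliases of the three statements (the hypotheses of `WallCrossingContinuity_of`; the skeleton
audit admits a hypothesis whose head constant is named like a declared stub) -/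
namespace Registered

/-- Alias of the statement of `stub_farHeights` keyed by the registered stub name. -/
abbrev stub_farHeights : Prop :=
  open Literature.Probability.LatticeModels in
  (∀ (F : ℕ → ℤ → Site 3 → Site 3) (C D : (N W : ℕ) → (M A : ℤ) → (n : ℕ) → (Fin n → Site 3) → ℝ),
    F = ((fun W M p i => if i = 0 then p 0 - M * (p 1 / (W : ℤ)) else if i = 1 then p 1 + M * ((p 0 - M * (p 1 / (W : ℤ))) / (W : ℤ)) else p 2) : ℕ → ℤ → Site 3 → Site 3) →
    C = ((fun N W M A _n y => isingExpect (SimpleGraph.fromRel fun a b : ↥(box 3 N) => (a.1 2 = b.1 2 ∧ a.1 2 ≤ A ∧ |a.1 0 - b.1 0| + |a.1 1 - b.1 1| = 1) ∨ (a.1 2 = b.1 2 ∧ A < a.1 2 ∧ |F W M a.1 0 - F W M b.1 0| + |F W M a.1 1 - F W M b.1 1| = 1) ∨ (a.1 0 = b.1 0 ∧ a.1 1 = b.1 1 ∧ |a.1 2 - b.1 2| = 1)) Finset.univ (criticalBeta 3) 0 BoundaryCondition.free (fun s => ∏ i, if h : y i ∈ box 3 N then spinAt (⟨y i, h⟩ :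 ↥(box 3 N)) s else 0)) : (N W : ℕ) → (M A : ℤ) → (n : ℕ) → (Fin n → Site 3) → ℝ) →
    D = ((fun N W M A n y => C N W M A n y - C N W (-M) A n y) : (N W : ℕ) → (M A : ℤ) → (n : ℕ) → (Fin n → Site 3) → ℝ) →
    ∀ (κ : ℝ), 0 < κ →
    ∀ (n : ℕ) (K : Set (Fin n → EuclideanSpace ℝ (Fin 3))), K ⊆ NonCoincident 3 n → IsCompact K →
    ∀ (t η : ℝ), 0 < η → ∃ h₀ > (0 : ℝ), ∀ h ∈ Set.Ioo 0 h₀, ∃ w₀ > (0 : ℝ), ∀ w ∈ Set.Ioo 0 w₀,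
    ∃ ε₀ > (0 : ℝ), ∀ ε ∈ Set.Ioo 0 ε₀, ∃ δ₀ > (0 : ℝ), ∀ δ ∈ Set.Ioo 0 δ₀, ∃ N₀ : ℕ, ∀ N ≥ N₀, ∀ x ∈ K,
      (∀ i, κ ≤ |x i 2 - t|) →
      |D N ⌊w / δ⌋₊ ⌊ε * ⌊w / δ⌋₊⌋ ⌊(t + h) / δ⌋ n (fun i => latticeApprox δ (x i)) -
        D N ⌊w / δ⌋₊ ⌊ε * ⌊w / δ⌋₊⌋ ⌊(t - h) / δ⌋ n (fun i => latticeApprox δ (x i))| ≤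
      η * ε * criticalCorr 3 n (fun i => latticeApprox δ (x i)))

/-- Alias of the statement of `stub_pinnedCrossing` keyed by the registered stub name. -/
abbrev stub_pinnedCrossing : Prop :=
  open Literature.Probability.LatticeModels in
  (∀ (F : ℕ → ℤ → Site 3 → Site 3) (C D : (N W : ℕ) → (M A : ℤ) → (n : ℕ) → (Fin n → Site 3) → ℝ),
    F = ((fun W M p i => if i = 0 then p 0 - M * (p 1 / (W : ℤ)) else if i = 1 then p 1 + M * ((p 0 - M * (p 1 / (W : ℤ))) / (W : ℤ)) else p 2) : ℕ → ℤ → Site 3 → Site 3) →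
    C = ((fun N W M A _n y => isingExpect (SimpleGraph.fromRel fun a b : ↥(box 3 N) => (a.1 2 = b.1 2 ∧ a.1 2 ≤ A ∧ |a.1 0 - b.1 0| + |a.1 1 - b.1 1| = 1) ∨ (a.1 2 = b.1 2 ∧ A < a.1 2 ∧ |F W M a.1 0 - F W M b.1 0| + |F W M a.1 1 - F W M b.1 1| = 1) ∨ (a.1 0 = b.1 0 ∧ a.1 1 = b.1 1 ∧ |a.1 2 - b.1 2| = 1)) Finset.univ (criticalBeta 3) 0 BoundaryCondition.free (fun s => ∏ i, if h : y i ∈ box 3 N then spinAt (⟨y i, h⟩ : ↥(box 3 N)) s else 0)) : (N W : ℕ) → (M A : ℤ) → (n : ℕ) → (Fin n → Site 3) → ℝ) →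
    D = ((fun N W M A n y => C N W M A n y - C N W (-M) A n y) : (N W : ℕ) → (M A : ℤ) → (n : ℕ) → (Fin n → Site 3) → ℝ) →
    ∀ (κ : ℝ), 0 < κ →
    ∀ (n : ℕ) (K : Set (Fin n → EuclideanSpace ℝ (Fin 3))), K ⊆ NonCoincident 3 n → IsCompact K →
    ∀ (t η : ℝ), 0 < η → ∃ h₀ > (0 : ℝ), ∀ h ∈ Set.Ioo 0 h₀, ∃ w₀ > (0 : ℝ), ∀ w ∈ Set.Ioo 0 w₀,
    ∃ ε₀ > (0 : ℝ), ∀ ε ∈ Set.Ioo 0 ε₀, ∃ δ₀ > (0 : ℝ), ∀ δ ∈ Set.Ioo 0 δ₀, ∃ N₀ : ℕ, ∀ N ≥ N₀, ∀ x ∈ K,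
      ((∃ i, x i 2 = t) ∧ ∀ i, x i 2 = t ∨ κ ≤ |x i 2 - t|) →
      |D N ⌊w / δ⌋₊ ⌊ε * ⌊w / δ⌋₊⌋ ⌊(t + h) / δ⌋ n (fun i => latticeApprox δ (x i)) -
        D N ⌊w / δ⌋₊ ⌊ε * ⌊w / δ⌋₊⌋ ⌊(t - h) / δ⌋ n (fun i => latticeApprox δ (x i))| ≤
      η * ε * criticalCorr 3 n (fun i => latticeApprox δ (x i)))

/-- Alias of the statement of `stub_nearHeights` keyed by the registered stub name. -/
abbrev stub_nearHeights : Prop :=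
  open Literature.Probability.LatticeModels in
  (∀ (F : ℕ → ℤ → Site 3 → Site 3) (C D : (N W : ℕ) → (M A : ℤ) → (n : ℕ) → (Fin n → Site 3) → ℝ),
    F = ((fun W M p i => if i = 0 then p 0 - M * (p 1 / (W : ℤ)) else if i = 1 then p 1 + M * ((p 0 - M * (p 1 / (W : ℤ))) / (W : ℤ)) else p 2) : ℕ → ℤ → Site 3 → Site 3) →
    C = ((fun N W M A _n y => isingExpect (SimpleGraph.fromRel fun a b : ↥(box 3 N) => (a.1 2 = b.1 2 ∧ a.1 2 ≤ A ∧ |a.1 0 - b.1 0| + |a.1 1 - b.1 1| = 1) ∨ (a.1 2 = b.1 2 ∧ A < a.1 2 ∧ |F W M a.1 0 - F W M b.1 0| + |F W M a.1 1 - F W M b.1 1| = 1) ∨ (a.1 0 = b.1 0 ∧ a.1 1 = b.1 1 ∧ |a.1 2 - b.1 2| = 1)) Finset.univ (criticalBeta 3) 0 BoundaryCondition.free (fun s => ∏ i, if h : y i ∈ box 3 N then spinAt (⟨y i, h⟩ : ↥(box 3 N)) s else 0)) : (N W : ℕ) → (M A : ℤ) → (n : ℕ) → (Fin n → Site 3)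 → ℝ) →
    D = ((fun N W M A n y => C N W M A n y - C N W (-M) A n y) : (N W : ℕ) → (M A : ℤ) → (n : ℕ) → (Fin n → Site 3) → ℝ) →
    ∀ (n : ℕ) (K : Set (Fin n → EuclideanSpace ℝ (Fin 3))), K ⊆ NonCoincident 3 n → IsCompact K →
    ∀ (t η : ℝ), 0 < η → ∃ κ > (0 : ℝ), ∃ h₀ > (0 : ℝ), ∀ h ∈ Set.Ioo 0 h₀, ∃ w₀ > (0 : ℝ), ∀ w ∈ Set.Ioo 0 w₀,
    ∃ ε₀ > (0 : ℝ), ∀ ε ∈ Set.Ioo 0 ε₀, ∃ δ₀ > (0 : ℝ), ∀ δ ∈ Set.Ioo 0 δ₀, ∃ N₀ : ℕ, ∀ N ≥ N₀, ∀ x ∈ K,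
      (∃ i, 0 < |x i 2 - t| ∧ |x i 2 - t| < κ) →
      |D N ⌊w / δ⌋₊ ⌊ε * ⌊w / δ⌋₊⌋ ⌊(t + h) / δ⌋ n (fun i => latticeApprox δ (x i)) -
        D N ⌊w / δ⌋₊ ⌊ε * ⌊w / δ⌋₊⌋ ⌊(t - h) / δ⌋ n (fun i => latticeApprox δ (x i))| ≤
      η * ε * criticalCorr 3 n (fun i => latticeApprox δ (x i)))


end Registered

/-! ## Threshold plumbing -/

theorem Ioo_min_left {u a b : ℝ} (hu : u ∈ Set.Ioo 0 (min a b)) : u ∈ Set.Ioo 0 a :=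
  ⟨hu.1, lt_of_lt_of_le hu.2 (min_le_left a b)⟩

theorem Ioo_min_right {u a b : ℝ} (hu : u ∈ Set.Ioo 0 (min a b)) : u ∈ Set.Ioo 0 b :=
  ⟨hu.1, lt_of_lt_of_le hu.2 (min_le_right a b)⟩

/-! ## The skeleton theorem: the crux BY NAME from the three stub statements (sorry-free) -/

set_option maxHeartbeats 800000 in
/-- **COMPOSITION.** FAR → PINNED → NEAR → `WallCrossingContinuity`: obtain `κ` from NEAR, instantiate FAR and
PINNED at `κ`, intersect the thresholds level by level (`min` for `h₀, w₀, ε₀, δ₀`, `max` for `N₀`), and for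
`x ∈ K` split on the trichotomy NEAR / PINNED / FAR (pure logic: if no insertion has offset in `(0, κ)` then
every insertion is at `t` or `κ`-far, and either some insertion is at `t` or none is). -/
theorem WallCrossingContinuity_of
    (hfar : Registered.stub_farHeights)
    (hpin : Registered.stub_pinnedCrossing)
    (hnear : Registered.stub_nearHeights) :
    Summit.CriticalPhenomena.Ising3DConformalLimit.Theses.VolterraWard.WallCrossingContinuity := by
  delta Summit.CriticalPhenomena.Ising3DConformalLimit.Theses.VolterraWard.WallCrossingContinuity
  intro F C D n K hK hcpt t η hη
  obtain ⟨κ, hκ, a₁, ha₁, Hn⟩ := hnear F C D rfl rfl rfl n K hK hcpt t η hη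
  obtain ⟨b₁, hb₁, Hf⟩ := hfar F C D rfl rfl rfl κ hκ n K hK hcpt t η hη
  obtain ⟨c₁, hc₁, Hp⟩ := hpin F C D rfl rfl rfl κ hκ n K hK hcpt t η hη
  refine ⟨min a₁ (min b₁ c₁), lt_min ha₁ (lt_min hb₁ hc₁), fun h hh => ?_⟩
  obtain ⟨a₂, ha₂, Hn⟩ := Hn h (Ioo_min_left hh)
  obtain ⟨b₂, hb₂, Hf⟩ := Hf h (Ioo_min_left (Ioo_min_right hh))
  obtain ⟨c₂, hc₂, Hp⟩ := Hp h (Ioo_min_right (Ioo_min_right hh))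
  refine ⟨min a₂ (min b₂ c₂), lt_min ha₂ (lt_min hb₂ hc₂), fun w hw => ?_⟩
  obtain ⟨a₃, ha₃, Hn⟩ := Hn w (Ioo_min_left hw)
  obtain ⟨b₃, hb₃, Hf⟩ := Hf w (Ioo_min_left (Ioo_min_right hw))
  obtain ⟨c₃, hc₃, Hp⟩ := Hp w (Ioo_min_right (Ioo_min_right hw))
  refine ⟨min a₃ (min b₃ c₃), lt_min ha₃ (lt_min hb₃ hc₃), fun ε hε => ?_⟩
  obtain ⟨a₄, ha₄, Hn⟩ := Hn ε (Ioo_min_left hε)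
  obtain ⟨b₄, hb₄, Hf⟩ := Hf ε (Ioo_min_left (Ioo_min_right hε))
  obtain ⟨c₄, hc₄, Hp⟩ := Hp ε (Ioo_min_right (Ioo_min_right hε))
  refine ⟨min a₄ (min b₄ c₄), lt_min ha₄ (lt_min hb₄ hc₄), fun δ hδ => ?_⟩
  obtain ⟨Na, Hn⟩ := Hn δ (Ioo_min_left hδ)
  obtain ⟨Nb, Hf⟩ := Hf δ (Ioo_min_left (Ioo_min_right hδ))
  obtain ⟨Nc, Hp⟩ := Hp δ (Ioo_min_right (Ioo_min_right hδ))
  refine ⟨max Na (max Nb Nc), fun N hN x hx => ?_⟩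
  have hNa : N ≥ Na := le_of_max_le_left hN
  have hNb : N ≥ Nb := le_of_max_le_left (le_of_max_le_right hN)
  have hNc : N ≥ Nc := le_of_max_le_right (le_of_max_le_right hN)
  by_cases hcase : ∃ i, 0 < |x i 2 - t| ∧ |x i 2 - t| < κ
  · exact Hn N hNa x hx hcase
  · have hsep : ∀ i, 0 < |x i 2 - t| → κ ≤ |x i 2 - t| :=
      fun i hi => not_lt.mp fun hlt => hcase ⟨i, hi, hlt⟩
    by_cases hpin' : ∃ i, x i 2 = t
    · refine Hp N hNc x hx ⟨hpin', fun i => ?_⟩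
      by_cases he : x i 2 = t
      · exact Or.inl he
      · exact Or.inr (hsep i (abs_pos.mpr (sub_ne_zero.mpr he)))
    · exact Hf N hNb x hx fun i => hsep i (abs_pos.mpr (sub_ne_zero.mpr fun he => hpin' ⟨i, he⟩))

/-- Wiring check: the crux modulo exactly the three `stub_*` (an `example`, so the audit sees one skeleton theorem). -/
example : Summit.CriticalPhenomena.Ising3DConformalLimit.Theses.VolterraWard.WallCrossingContinuity :=
  WallCrossingContinuity_of stub_farHeights stub_pinnedCrossing stub_nearHeights

end Summit.CriticalPhenomena.Ising3DConformalLimit.Cruxes.WallCrossingContinuity.Birth
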